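import Mathlib
import Summits.KontsevichZagierPeriods.Zeta5Search.BrickPhiFour
import Literature.NumberTheory.Congruences.GlaisherHarmonicCongruences
import Literature.NumberTheory.LFunctions.GeneralizedBernoulliNumbers

/-!
# BrickHarmonicBlocks — (B2) the HARMONIC BLOCKS of zi-p2 THEOREMS 5/6: `p^s·H_{jp}^{(s)} = H_j^{(s)} + p^s·V_s(jp)`
exactly, and `v_p(p^s·V_s(jp)) ≥ 3` for every `s ≥ 1`, `p ≥ 5` (cell zeta5-irr)

HONEST FRAMING: systematic search; no irrationality claim unless certified. INSTRUMENT lemma of the ζ(5)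
census cell zeta5-irr (HOME `run/shared/lean/pub/zeta5-irr/`; memo `zi-p2/probes/B8/thm6/THEOREM6.md` Step B:
«(B2) Harmonic blocks: `p^sH_{jp}^{(s)} = H_j^{(s)} + p^sV_s(jp)`, `V_s(jp) = Σ_{b<j}σ_s(b)`, `σ_s(b) = Σ_{r=1}^{p−1}(bp+r)^{−s}`,
with `v(p^sV_s(jp)) ≥ 3` for every `s ≥ 1`» — the input of the constant-term cell `s = 0` (`cell^{(0)}_K =
−Σ_s c_{K,s}H_K^{(s)}`), Steps D (D2) / E⁺ (s = 0)). Nothing here is about ζ(5); no irrationality content; filing moves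
no rung. Filed by the engine seat zi-eng (g8); inputs: Wolstenholme `v_p(pH_{p−1}) ≥ 3`
(`BrickPhiFour.padicValuation_prime_mul_harmonic_le`), Glaisher `Σ_{k<p}k^{−2} ≡ (2/3)pB_{p−3} (mod p²)`
(`Glaisher.padicValuation_sum_inv_sq_sub_le`), von Staudt integrality (`padicValuation_bernoulli_le_one`).

## The statement

`hsum s K = H_K^{(s)} := Σ_{i=1}^{K} i^{−s}` (the sum in `BrickPartialFractions.cellZero`), `blockSigma p s b = σ_s(b) :=
Σ_{0<r<p}(bp+r)^{−s}`. Then for every prime `p` and all `s, j` (`pow_mul_hsum_mul`):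
**`p^s·H_{jp}^{(s)} = H_j^{(s)} + p^s·Σ_{b<j}σ_s(b)`**; and for `p ≥ 5`, `s ≥ 1`, every `b`
(`padicValuation_pow_mul_blockSigma_le`): **`v(p^s·σ_s(b)) ≤ exp(−3)`**, hence (`padicValuation_pow_mul_blockSum_le`)
**`v(p^s·Σ_{b<j}σ_s(b)) ≤ exp(−3)`** — `σ_1(b) ≡ H_{p−1} − bp·Σr^{−2} ≡ 0 (mod p²)`, `σ_2(b) ≡ Σr^{−2} ≡ 0 (mod p)`.
-/

namespace Summit.KontsevichZagierPeriods.Zeta5Search.BrickHarmonicBlocks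

open Finset Nat WithZero
open Summit.KontsevichZagierPeriods.Zeta5Search.BrickPhiFour (padicValuation_prime_mul_harmonic_le)
open Literature.NumberTheory.Congruences.Glaisher (padicValuation_sum_inv_sq_sub_le)
open Literature.NumberTheory.LFunctions (padicValuation_bernoulli_le_one padicValuation_natCast_le_one
  padicValuation_natCast_eq_one)

variable {p : ℕ} [Fact p.Prime]

/-- `H_K^{(s)} = Σ_{i=1}^{K} 1/i^s`. -/
def hsum (s K : ℕ) : ℚ := ∑ i ∈ Icc 1 K, 1 / (i : ℚ) ^ s

/-- `σ_s(b) = Σ_{0<r<p} 1/(bp + r)^s` — one complete residue block without its multiple of `p`. -/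
def blockSigma (p s b : ℕ) : ℚ := ∑ r ∈ Ico 1 p, 1 / ((b * p + r : ℕ) : ℚ) ^ s

omit [Fact p.Prime] in
/-- `H^{(s)}_{K+t} = H^{(s)}_K + Σ_{r=1}^{t} 1/(K+r)^s`. -/
theorem hsum_add (s K t : ℕ) : hsum s (K + t) = hsum s K + ∑ r ∈ Icc 1 t, 1 / ((K + r : ℕ) : ℚ) ^ s := by
  induction t with
  | zero => simp [hsum]
  | succ t ih =>
    rw [← add_assoc, hsum, Finset.sum_Icc_succ_top (by omega), ← hsum, ih, Finset.sum_Icc_succ_top (by omega),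
      add_assoc, Nat.add_assoc]

/-- **(B2) exact**: `p^s·H_{jp}^{(s)} = H_j^{(s)} + p^s·Σ_{b<j}σ_s(b)`. -/
theorem pow_mul_hsum_mul (s j : ℕ) :
    (p : ℚ) ^ s * hsum s (j * p) = hsum s j + (p : ℚ) ^ s * ∑ b ∈ range j, blockSigma p s b := by
  have hp : p.Prime := Fact.out
  have hpQ : (p : ℚ) ≠ 0 := by exact_mod_cast hp.ne_zero
  induction j with
  | zero => simp [hsum]
  | succ j ih =>
    have hblock : hsum s ((j + 1) * p) = hsum s (j * p) + (1 / (((j + 1) * p : ℕ) : ℚ) ^ s + blockSigma p s j) := by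
      rw [show (j + 1) * p = j * p + p by ring, hsum_add, blockSigma, ← Finset.Ico_insert_right hp.one_le,
        Finset.sum_insert Finset.right_notMem_Ico, show j * p + p = (j + 1) * p by ring]
    have hstep : hsum s (j + 1) = hsum s j + 1 / ((j + 1 : ℕ) : ℚ) ^ s := by
      rw [hsum, Finset.sum_Icc_succ_top (by omega), ← hsum]
    have hterm : (p : ℚ) ^ s * (1 / (((j + 1) * p : ℕ) : ℚ) ^ s) = 1 / ((j + 1 : ℕ) : ℚ) ^ s := by
      push_cast
      rw [mul_pow]
      field_simp
    rw [hblock, mul_add, mul_add, ih, hstep, Finset.sum_range_succ, hterm]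
    ring

/-! ## Valuations of the blocks -/

/-- Every block sum is `p`-integral: `v(σ_s(b)) ≤ 1`. -/
theorem padicValuation_blockSigma_le_one (s b : ℕ) : Rat.padicValuation p (blockSigma p s b) ≤ 1 := by
  have hp : p.Prime := Fact.out
  refine Valuation.map_sum_le _ fun r hr => ?_
  have hr' := mem_Ico.1 hr
  rw [one_div, map_inv₀, map_pow, padicValuation_natCast_eq_one (fun h => ?_), one_pow, inv_one]
  have : p ∣ r := (Nat.dvd_add_right (dvd_mul_left p b)).1 h
  exact absurd (Nat.le_of_dvd (by omega) this) (by omega)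

/-- `v(H_{p−1}) ≥ 2` (Wolstenholme) in the `Ico 1 p` form. -/
theorem padicValuation_harmonic_le (h3 : 3 < p) : Rat.padicValuation p (∑ r ∈ Ico 1 p, 1 / ((r : ℕ) : ℚ)) ≤ exp (-2) := by
  have hp : p.Prime := Fact.out
  have hH : ∑ r ∈ Ico 1 p, 1 / ((r : ℕ) : ℚ) = harmonic (p - 1) := by
    rw [harmonic_eq_sum_Icc, show Icc 1 (p - 1) = Ico 1 p from by ext r; simp only [mem_Icc, mem_Ico]; omega]
    simp
  have h := padicValuation_prime_mul_harmonic_le (p := p) h3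
  rw [map_mul, Rat.padicValuation_self] at h
  rw [hH]
  calc Rat.padicValuation p (harmonic (p - 1)) = exp 1 * (exp (-1) * Rat.padicValuation p (harmonic (p - 1))) := by
        rw [← mul_assoc, ← exp_add]; norm_num
    _ ≤ exp 1 * exp (-3) := mul_le_mul' le_rfl h
    _ = exp (-2) := by rw [← exp_add]; norm_num

/-- `v(Σ_{0<r<p} r^{−2}) ≥ 1` (from Glaisher's `Σr^{−2} ≡ (2/3)pB_{p−3} (mod p²)` and von Staudt). -/
theorem padicValuation_sum_inv_sq_le (h3 : 3 < p) :
    Rat.padicValuation p (∑ r ∈ Ico 1 p, 1 / ((r : ℕ) : ℚ) ^ 2) ≤ exp (-1) := by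
  have hp : p.Prime := Fact.out
  have h5 : 5 ≤ p := by
    rcases Nat.lt_or_ge p 5 with h | h
    · exfalso; interval_cases p; norm_num at hp
    · exact h
  have hG := padicValuation_sum_inv_sq_sub_le (p := p) h5
  have e : ∑ r ∈ Ico 1 p, 1 / ((r : ℕ) : ℚ) ^ 2 = ∑ k ∈ Ico 1 p, ((k : ℚ)⁻¹) ^ 2 := by
    refine Finset.sum_congr rfl fun r _ => ?_; rw [one_div, inv_pow]
  have hB : Rat.padicValuation p ((2 / 3 : ℚ) * p * bernoulli (p - 3)) ≤ exp (-1) := by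
    rw [map_mul, map_mul, Rat.padicValuation_self, map_div₀,
      show (2 : ℚ) = ((2 : ℕ) : ℚ) by norm_num, show (3 : ℚ) = ((3 : ℕ) : ℚ) by norm_num,
      padicValuation_natCast_eq_one (fun h => by have := Nat.le_of_dvd (by norm_num) h; omega),
      padicValuation_natCast_eq_one (fun h => by have := Nat.le_of_dvd (by norm_num) h; omega), div_one, one_mul]
    calc exp (-1 : ℤ) * Rat.padicValuation p (bernoulli (p - 3)) ≤ exp (-1) * 1 :=
          mul_le_mul' le_rfl (padicValuation_bernoulli_le_one (by omega))
      _ = exp (-1) := mul_one _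
  rw [e, show ∑ k ∈ Ico 1 p, ((k : ℚ)⁻¹) ^ 2 = (∑ k ∈ Ico 1 p, ((k : ℚ)⁻¹) ^ 2 - (2 / 3 : ℚ) * p * bernoulli (p - 3)) +
    (2 / 3 : ℚ) * p * bernoulli (p - 3) by ring]
  exact (Valuation.map_add _ _ _).trans (max_le (hG.trans (exp_le_exp.2 (by norm_num))) hB)

/-- **The block valuations**: `v(p^s·σ_s(b)) ≤ exp(−3)` for `p ≥ 5`, `s ≥ 1`, every `b`. -/
theorem padicValuation_pow_mul_blockSigma_le (h3 : 3 < p) {s : ℕ} (hs : 1 ≤ s) (b : ℕ) :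
    Rat.padicValuation p ((p : ℚ) ^ s * blockSigma p s b) ≤ exp (-3) := by
  have hp : p.Prime := Fact.out
  have hpQ : (p : ℚ) ≠ 0 := by exact_mod_cast hp.ne_zero
  have hunit : ∀ r ∈ Ico 1 p, Rat.padicValuation p ((r : ℕ) : ℚ) = 1 := fun r hr =>
    padicValuation_natCast_eq_one fun h => by have := mem_Ico.1 hr; exact absurd (Nat.le_of_dvd (by omega) h) (by omega)
  have hunit' : ∀ r ∈ Ico 1 p, Rat.padicValuation p (((b * p + r : ℕ)) : ℚ) = 1 := fun r hr =>
    padicValuation_natCast_eq_one fun h => by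
      have := mem_Ico.1 hr
      have : p ∣ r := (Nat.dvd_add_right (dvd_mul_left p b)).1 h
      exact absurd (Nat.le_of_dvd (by omega) this) (by omega)
  have hbp : Rat.padicValuation p ((b * p : ℕ) : ℚ) ≤ exp (-1) := by
    push_cast; rw [map_mul, Rat.padicValuation_self]
    calc _ ≤ 1 * exp (-1 : ℤ) := mul_le_mul' (padicValuation_natCast_le_one _) le_rfl
      _ = _ := one_mul _
  rw [map_mul, map_pow, Rat.padicValuation_self, ← exp_nsmul]
  rcases Nat.lt_or_ge s 3 with hs3 | hs3
  · interval_cases s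
    · -- `s = 1`: `σ_1(b) = Σ 1/r − bp·Σ 1/r² + Σ (bp)²/(r²(bp+r))`
      have hdec : blockSigma p 1 b = ∑ r ∈ Ico 1 p, 1 / ((r : ℕ) : ℚ) - ((b * p : ℕ) : ℚ) * ∑ r ∈ Ico 1 p, 1 / ((r : ℕ) : ℚ) ^ 2 +
          ∑ r ∈ Ico 1 p, ((b * p : ℕ) : ℚ) ^ 2 / (((r : ℕ) : ℚ) ^ 2 * ((b * p + r : ℕ) : ℚ)) := by
        rw [blockSigma, Finset.mul_sum, ← Finset.sum_sub_distrib, ← Finset.sum_add_distrib]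
        refine Finset.sum_congr rfl fun r hr => ?_
        have hr0 : ((r : ℕ) : ℚ) ≠ 0 := by have := mem_Ico.1 hr; exact_mod_cast (show r ≠ 0 by omega)
        have hbr : ((b * p + r : ℕ) : ℚ) ≠ 0 := by have := mem_Ico.1 hr; exact_mod_cast (show b * p + r ≠ 0 by omega)
        rw [pow_one]
        field_simp
        push_cast; ring
      rw [hdec]
      refine (mul_le_mul' le_rfl ((Valuation.map_add _ _ _).trans (max_le ((Valuation.map_sub _ _ _).trans
        (max_le (padicValuation_harmonic_le h3) ?_)) ?_))).trans ?_
      · rw [map_mul]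
        calc _ ≤ exp (-1) * exp (-1) := mul_le_mul' hbp (padicValuation_sum_inv_sq_le h3)
          _ = exp (-2) := by rw [← exp_add]; norm_num
      · refine Valuation.map_sum_le _ fun r hr => ?_
        rw [map_div₀, map_mul, map_pow, map_pow, hunit r hr, hunit' r hr, one_pow, one_mul, div_one]
        calc _ ≤ exp (-1 : ℤ) ^ 2 := pow_le_pow_left' hbp 2
          _ = exp (-2) := by rw [← exp_nsmul]; norm_num
      · rw [← exp_add]; norm_num
    · -- `s = 2`: `σ_2(b) = Σ 1/r² − Σ bp(bp+2r)/(r²(bp+r)²)`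
      have hdec : blockSigma p 2 b = ∑ r ∈ Ico 1 p, 1 / ((r : ℕ) : ℚ) ^ 2 -
          ∑ r ∈ Ico 1 p, ((b * p : ℕ) : ℚ) * (((b * p : ℕ) : ℚ) + 2 * r) / (((r : ℕ) : ℚ) ^ 2 * ((b * p + r : ℕ) : ℚ) ^ 2) := by
        rw [blockSigma, ← Finset.sum_sub_distrib]
        refine Finset.sum_congr rfl fun r hr => ?_
        have hr0 : ((r : ℕ) : ℚ) ≠ 0 := by have := mem_Ico.1 hr; exact_mod_cast (show r ≠ 0 by omega)
        have hbr : ((b * p + r : ℕ) : ℚ) ≠ 0 := by have := mem_Ico.1 hr; exact_mod_cast (show b * p + r ≠ 0 by omega)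
        field_simp
        push_cast; ring
      rw [hdec]
      refine (mul_le_mul' le_rfl ((Valuation.map_sub _ _ _).trans (max_le (padicValuation_sum_inv_sq_le h3) ?_))).trans ?_
      · refine Valuation.map_sum_le _ fun r hr => ?_
        rw [map_div₀, map_mul, map_mul, map_pow, map_pow, hunit r hr, hunit' r hr, one_pow, one_mul, div_one]
        calc _ ≤ exp (-1) * 1 := mul_le_mul' hbp ?_
          _ = exp (-1) := mul_one _
        rw [show ((b * p : ℕ) : ℚ) + 2 * r = (((b * p + 2 * r : ℕ)) : ℚ) by push_cast; ring]
        exact padicValuation_natCast_le_one _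
      · rw [← exp_add]; norm_num
  · -- `s ≥ 3`
    calc exp (s • (-1 : ℤ)) * Rat.padicValuation p (blockSigma p s b) ≤ exp (s • (-1 : ℤ)) * 1 :=
          mul_le_mul' le_rfl (padicValuation_blockSigma_le_one s b)
      _ ≤ exp (-3) := by rw [mul_one, exp_le_exp]; simp; omega

/-- **(B2) valuation**: `v(p^s·V_s(jp)) ≤ exp(−3)`, `V_s(jp) = Σ_{b<j}σ_s(b)` (`p ≥ 5`, `s ≥ 1`). -/
theorem padicValuation_pow_mul_blockSum_le (h3 : 3 < p) {s : ℕ} (hs : 1 ≤ s) (j : ℕ) :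
    Rat.padicValuation p ((p : ℚ) ^ s * ∑ b ∈ range j, blockSigma p s b) ≤ exp (-3) := by
  rw [Finset.mul_sum]
  exact Valuation.map_sum_le _ fun b _ => padicValuation_pow_mul_blockSigma_le h3 hs b

end Summit.KontsevichZagierPeriods.Zeta5Search.BrickHarmonicBlocks
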